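import Literature.NumberTheory.EllipticCurves.Jetchev2008.CoreVertices
import Literature.NumberTheory.GaloisCohomology.KolyvaginSystems
import HarnessLib

/-!
# Jetchev 2008, §3.3–3.4 (printed) = §4.3 and Def. 4.8 (arXiv): the modified Kummer Selmer
# structures `𝓕(c)` and `𝓕_⌈q⌉(c)` AS SELMER STRUCTURES (place-indexed local conditions)

D. Jetchev, *Global divisibility of Heegner points and Tamagawa numbers*, Compos. Math. **144**
(2008) 811–826 = arXiv:math/0703431 (bib `Jetchev2008`; held texts: arXiv `paper:arxiv-math_0703431`
`arXiv pNNNN:Lnn`, print `paper:url-36a580584b69` `url p000k` = p. 810+k; numbering concordance in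
`Jetchev2008/HeegnerPointGlobalDivisibility.lean`). Sibling of `Jetchev2008/CoreVertices.lean`
(p485508), which defines the Selmer MODULE `H_{𝓕(c)}` directly as a subgroup of `H¹(K, E[n])`
(`modifiedSelmerGroup`, with the transverse condition rendered GLOBALLY as `transverseKer`) and the
core-vertex predicate, and which leaves *"the transverse subgroup as a `SelmerStructure` LOCAL
condition … and the connected variant `𝓕_⌈q⌉(c)` (printed §3.3.2)"* to the instantiation layer
(its scope note). This file supplies exactly that layer's DEFINITIONS — nothing is asserted:

* `placesDividing K c` — the finite set of primes of `K` dividing `c` (the places *"`v ∣ abc`"* of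
  printed §3.4.1).
* `selmerF W n 𝒯 S` — printed §3.4.1 with `a = b = 1` (p. 816 [url p0006 L67–L85] = arXiv §4.3
  item 3, p0012:L44–55): the Kummer Selmer structure `𝓕` (printed §3.3.1 = the tree's
  `WeierstrassCurve.kummerSelmerStructure`) with the local condition REPLACED at the places of `S`
  (= `placesDividing K c`) by a transverse family `𝒯`, as a `DiscreteGaloisModule.SelmerStructure`
  (Mazur–Rubin Def. 2.1.1; the tree's `SelmerStructure.transverseAt`, `KolyvaginSystems.lean`) —
  the shape on which the tree's Poitou–Tate duality for Selmer structures
  (`poitouTate_selmerStructure_duality`, kernel counting form `JET.GlobalDuality.*`) operates. The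
  LOCAL transverse family `𝒯` (printed §3.1.2, p. 814 [url p0004 L28–L37]:
  `H¹_tr(K_λ, E[p^m]) := ker{H¹(K_λ, E[p^m]) → H¹(K[ℓ]_λ, E[p^m])}`) is a PARAMETER: the tree's
  `DiscreteGaloisModule.transverseSubgroup (ρ.toLocal λ) L` gives it for any `K_λ`-algebra `L`, but
  the completion `K[ℓ]_λ` as a `K_λ`-algebra is not constructed in the tree; the sibling's GLOBAL
  `transverseKer` is the condition it must cut out (reconciliation lemma in the cell's Summits
  companion `Theorems/Rank1ResidualJetSelmerLemmas.lean`).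
  -- TODO(general form): `𝒯 (λ) = transverseSubgroup _ K[ℓ]_λ` (printed §3.1.2).
* `selmerF0 W n 𝒯 𝒮 S Q` — printed §3.3.2 (p. 816) = arXiv Def. 4.8 (p0012:L80–83, verbatim:
  *"Define a new Selmer structure `𝓕_⌈q₁…q_s⌉` on `E[p^m]` in the same way as `𝓕` except that for
  each places `v ∣ q_i` …, the local condition at `v` is replaced by the stringent Kummer condition
  `H¹_{Kum⁰}(K_v, E[p^m])`"*), then modified at `c` as above: `selmerF W n 𝒯 S` with a stringent
  family `𝒮` at the places `Q` (= `placesDividing K q`). `𝒮` is a PARAMETER: the intended value,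
  printed §3.1 *"connected Kummer condition … the image of `E⁰(K_v)`"* (arXiv §4.1 item 4,
  p0009:L59–64), is the cell's `X11b.Three.JetchevKummer.connectedKummerCondition` — a Summits
  declaration, not importable here. -- TODO(general form): instantiate `𝒮` (printed §3.1).
* `selmerPart W K τ n 𝓖 e` and `IsCoreVertex W K τ p k 𝒯 S` — printed §5.2 (p. 821) at the
  STRUCTURE level: `H_𝓖^{±}` (the sibling's `signPart` on `𝓖.selmerGroup`) and «core vertex for `k`»
  for `𝓕(c) = selmerF …`; the sibling's `IsGlobalCoreVertex` is the parameter-free module-level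
  rendering.
The relaxed/strict variants `𝓕^a(c)`, `𝓕_b(c)` (printed §3.4.1) are the tree's
`SelmerStructure.relaxedAt` / `strictAt` and are not renamed. Typed for the cell `bsd-jet`
(run/shared/lean/pub/bsd-jet/, road K; seat `bsd-jet-pv-2`; design note
`HOME/sheets/PV2-J6-S2-DESIGN.md`). HONEST FRAMING (programme §HONESTY): definitions move no class;
typed ≠ proved ≠ endorsed.

References: [cite: Jetchev2008, §3.1 (pp. 813–814), §3.3.1–3.3.2 and §3.4.1 (p. 816) = arXiv §4.1, §4.3, Def. 4.8]
[cite: MazurRubin2004, Def. 2.1.1 (Selmer structures) — cited through Jetchev; not held].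
-/

noncomputable section

open scoped Classical

open WeierstrassCurve IsDedekindDomain NumberField
  Literature.NumberTheory.GaloisRepresentations
  Literature.NumberTheory.GaloisRepresentations.DiscreteGaloisModule

universe u

namespace Literature.NumberTheory.EllipticCurves.Jetchev2008

variable {K : Type u} [Field K] [NumberField K] (W : WeierstrassCurve ℚ)

/-- **The primes of `K` dividing `c`**: the finite set `{λ : λ ∣ (c)}` of non-zero primes of `𝓞_K`
dividing `c` (empty for `c = 0` by convention; for a Kolyvagin conductor `c` — a square-free product
of primes inert in `K` — the ideals `(ℓ)`, `ℓ ∣ c`; for a carrier `q` split in `K` the two places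
`v, v̄`). The index set of the modifications *"at the places `v ∣ abc`"* of printed §3.4.1; the
sibling's `PlaceOver K v ℓ` is the same incidence for one rational prime.
[cite: Jetchev2008, §3.4.1 (p. 816)] -/
def placesDividing (K : Type u) [Field K] [NumberField K] (c : ℕ) :
    Finset (HeightOneSpectrum (𝓞 K)) :=
  if h : Ideal.span {(c : 𝓞 K)} = ⊥ then ∅ else (Ideal.finite_factors h).toFinset

/-- **Printed §3.4.1 with `a = b = 1`: the Selmer structure `𝓕(c)` on `E[n]` over `K`** (p. 816,
verbatim: *"The modified Selmer structure `𝓕^a_b(c)` is the structure whose local conditions are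
obtained from those of `𝓕` by simply replacing them at the places `v ∣ abc` as follows: if `v ∣ c`,
then `H¹_{𝓕^a_b(c)}(K_v, E[p^m]) = H¹_tr(K_v, E[p^m])` …"*, `𝓕` the Kummer structure of §3.3.1):
the tree's `(W⁄K).kummerSelmerStructure n` made TRANSVERSE (`SelmerStructure.transverseAt`) at the
finite set of places `S` (= `placesDividing K c`) for a transverse family `𝒯`, which is a
PARAMETER (intended: printed §3.1.2 `H¹_tr(K_λ, E[p^m])`; its global counterpart is the sibling's
`transverseKer` — see the module docstring). [cite: Jetchev2008, §3.4.1 and §3.3.1 (p. 816), §3.1.2 (p. 814)] -/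
def selmerF (n : ℤ) (𝒯 : SelmerStructure ((W.baseChange K).torsionGaloisModule n))
    (S : Finset (HeightOneSpectrum (𝓞 K))) :
    SelmerStructure ((W.baseChange K).torsionGaloisModule n) :=
  ((W.baseChange K).kummerSelmerStructure n).transverseAt 𝒯 S

/-- **Printed §3.3.2 = arXiv Def. 4.8, the stringent (connected) structure, modified at `c`:
`𝓕_⌈q⌉(c)`** (arXiv p0012:L80–83, verbatim: *"Define a new Selmer structure `𝓕_⌈q₁…q_s⌉` on
`E[p^m]` in the same way as `𝓕` except that for each places `v ∣ q_i` (`i = 1, …, s`), the local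
condition at `v` is replaced by the stringent Kummer condition `H¹_{Kum⁰}(K_v, E[p^m])`"*; used with
one prime `q` in printed Thm. 5.2 = arXiv Thm. 6.3): `selmerF W n 𝒯 S` with the family `𝒮` at the
finite set `Q` (= `placesDividing K q`; disjoint from `S` in print: `q ∣ N`, `c` prime to `N`).
`𝒮` is a PARAMETER (intended: printed §3.1, the image of `E⁰(K_v)` under `δ_v` = the cell's
Summits-side `connectedKummerCondition` — see the module docstring).
[cite: Jetchev2008, §3.3.2 (p. 816) and §3.1 (pp. 813–814) = arXiv Def. 4.8, §4.1 item 4] -/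
def selmerF0 (n : ℤ) (𝒯 𝒮 : SelmerStructure ((W.baseChange K).torsionGaloisModule n))
    (S Q : Finset (HeightOneSpectrum (𝓞 K))) :
    SelmerStructure ((W.baseChange K).torsionGaloisModule n) :=
  (selmerF W n 𝒯 S).modify 𝒮 ∅ ∅ Q

/-! ### Printed §5.2: the Selmer modules `H_𝓖^{±}` and core vertices, STRUCTURE level -/

section CoreVertex

variable (K : Type) [Field K] [NumberField K]

/-- **`H_𝓖^{e} := H¹_𝓖(K, E[n]) ∩ ker(τ − e)`** for a Selmer STRUCTURE `𝓖` on `E[n]` over `K`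
(printed §5.2, p. 821: *"we denote each Selmer module `H¹_{𝓖(c)}(K, E[p^m])` simply by `H_{𝓖(c)}`"*,
with its `±`-parts under complex conjugation `τ`, Thm. 3.3): the sibling's `signPart W K τ n e`
applied to the Selmer group `𝓖.selmerGroup` (Mazur–Rubin Def. 2.1.1). For `𝓖 = selmerF W n 𝒯 S`
this is `H_{𝓕(c)}^{±}` of printed Thm. 5.2 ∕ Prop. 5.3 at the structure level.
[cite: Jetchev2008, §5.2 (p. 821) and §3.2.2 (p. 815)] -/
def selmerPart (τ : K ≃ₐ[ℚ] K) (n : ℤ)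
    (𝓖 : SelmerStructure ((W.baseChange K).torsionGaloisModule n)) (e : ℤ) :
    AddSubgroup (galoisCohomology ((W.baseChange K).torsionGaloisModule n) 1) :=
  signPart W K τ n e 𝓖.selmerGroup

/-- **Core vertex, STRUCTURE level** (printed §5.2, p. 821, verbatim: *"we define a core vertex for
`m` and for the Kummer Selmer structure `𝓕` to be any conductor `c ∈ Λ_m`, such that either
`Inv H⁺_{𝓕(c)} = (m)` and `Inv H⁻_{𝓕(c)} = ()`, or `Inv H⁺_{𝓕(c)} = ()` and `Inv H⁻_{𝓕(c)} = (m)`"*):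
for the level `n = p^k`, the structure `𝓕(c) = selmerF W (p^k) 𝒯 S` (`S` = the places dividing `c`,
transverse family `𝒯` a PARAMETER) and `τ`: EITHER `H⁺` is cyclic of order `p^k` and `H⁻ = 0`, OR
`H⁺ = 0` and `H⁻` is cyclic of order `p^k` — the same two clauses as the sibling's parameter-free
`IsGlobalCoreVertex W K ι τ p k c` (stated on `modifiedSelmerGroup`, global transverse condition),
to which it reduces when `𝒯` cuts out `transverseKer` (cell companion
`Theorems/Rank1ResidualJetSelmerLemmas.lean`). The clause `c ∈ Λ_k` is NOT part of the predicate.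
[cite: Jetchev2008, §5.2 (p. 821; arXiv §6.2 p0015 L33–L48)] -/
def IsCoreVertex (τ : K ≃ₐ[ℚ] K) (p k : ℕ)
    (𝒯 : SelmerStructure ((W.baseChange K).torsionGaloisModule ((p ^ k : ℕ) : ℤ)))
    (S : Finset (HeightOneSpectrum (𝓞 K))) : Prop :=
  let n : ℤ := ((p ^ k : ℕ) : ℤ)
  let Hp := selmerPart W K τ n (selmerF W n 𝒯 S) 1
  let Hm := selmerPart W K τ n (selmerF W n 𝒯 S) (-1)
  (IsAddCyclic Hp ∧ Nat.card Hp = p ^ k ∧ Hm = ⊥) ∨ (Hp = ⊥ ∧ IsAddCyclic Hm ∧ Nat.card Hm = p ^ k)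

end CoreVertex

end Literature.NumberTheory.EllipticCurves.Jetchev2008

end
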